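import Summits.FinalStateConjecture.FinalStateConjecture.Theorems.ClusterCompletenessAdiabaticMultiKerrILEDHorizonFactor
import Literature.Geometry.Lorentzian.KerrDomainOfDependence
import Literature.Geometry.Lorentzian.KerrSchildDominantEnergy
import Literature.Geometry.Lorentzian.KerrSchildWaveCauchyProblem

/-!
# Route ClusterCompleteness — crux `AdiabaticMultiKerrILED`, line `Sketch`: the slab weight

Helper file for the crux `stmt-FinalStateConjecture-14310`
(`Summit.FinalStateConjecture.FinalStateConjecture.Theses.ClusterCompleteness.AdiabaticMultiKerrILED`),
closing the stub `stub_slabWeight` of line `Sketch`.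

The weight of the finite-time (Hawking–Ellis) energy estimate on the multi-Kerr background is the
`N`-hole, boosted version of `Kerr.dodWeight`:
`W(x) = timeSlabCutoff(x⁰) · χ(u₁(x)) · ∏ᵢ χ(u₂ᵢ(qᵢ x)/εᵢ − 1)` with `χ = Real.smoothTransition`,
`u₁ = Kerr.coneFn A 0` the backward solid cone about the origin, `u₂ᵢ = Kerr.horizonFn Mᵢ aᵢ` the
receding horizon function of hole `i` and `qᵢ` its Poincaré map to the rest frame. We prove that `W`
is `C¹`, takes values in `[0, 1]`, is supported in
`{−2 < x⁰ < A} ∩ {‖x⃗‖ < A − x⁰} ∩ ⋂ᵢ {u₂ᵢ ∘ qᵢ > εᵢ}`, equals `1` on the slab core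
`{0 ≤ x⁰ ≤ T} ∩ {u₁ ≥ 1} ∩ ⋂ᵢ {u₂ᵢ ∘ qᵢ ≥ 2εᵢ}`, and that at slab exterior points where the
coefficient field `G` is pointwise of normalised generalised Kerr–Schild form (and exactly boosted
Kerr in the layers `{u₂ᵢ ∘ qᵢ ≤ 2εᵢ}`) the differential `dW` pairs nonpositively with the lab
`dt`-current `T^{μ0}[w]` (`KerrSchild.normalCurrent`) of every `w`. The last item is the Leibniz
rule: near the slab the time cut-off is `1`; the cone factor has signed flux for EVERY background
(`Kerr.coneFactor_flux`, applied to the constant background `η − φ₀ l₀ ⊗ l₀ = G(x)` — the current at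
`x` sees only `G(x)`); each horizon factor has signed flux in its layer (`stub_horizonFactor`) and is
locally `1` off it; all cofactors are nonnegative. Hawking–Ellis 1973, §4.3, Lemma 4.3.1 (the
region `𝒰` and the boundary terms over `(∂𝒰)₂`); O'Neill 1983, Ch. 14, Lemma 43. [folklore]
-/

noncomputable section

-- the doubled `FinalStateConjecture.FinalStateConjecture` path component trips dupNamespace
set_option linter.dupNamespace false

open scoped InnerProductSpace BigOperators Topology
open Literature.Geometry.Lorentzian

namespace Summit.FinalStateConjecture.FinalStateConjecture.Cruxes.AdiabaticMultiKerrILED.Sketch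

/-! ### Signed flux of products of nonnegative factors (Leibniz rule) -/

/-- **Leibniz rule for the flux of a product of two nonnegative factors**: if `g₁, g₂ ≥ 0` at `x`
are differentiable there and both differentials pair nonpositively with `J`, then so does the
differential of `g₁ g₂` (`d(g₁ g₂) = g₁ dg₂ + g₂ dg₁`). Hawking–Ellis 1973, §4.3, proof of
Lemma 4.3.1. [folklore] -/
private theorem sw_mul_flux {g₁ g₂ : E4 → ℝ} {x : E4} (J : Fin 4 → ℝ)
    (h₁ : DifferentiableAt ℝ g₁ x) (h₂ : DifferentiableAt ℝ g₂ x) (hg₁ : 0 ≤ g₁ x) (hg₂ : 0 ≤ g₂ x)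
    (hf₁ : ∑ μ, fderiv ℝ g₁ x (E4.basisVector μ) * J μ ≤ 0)
    (hf₂ : ∑ μ, fderiv ℝ g₂ x (E4.basisVector μ) * J μ ≤ 0) :
    ∑ μ, fderiv ℝ (fun y ↦ g₁ y * g₂ y) x (E4.basisVector μ) * J μ ≤ 0 := by
  rw [fderiv_fun_mul h₁ h₂]
  simp only [add_apply, FunLike.coe_smul, Pi.smul_apply,
    smul_eq_mul]
  calc ∑ μ, (g₁ x * fderiv ℝ g₂ x (E4.basisVector μ) + g₂ x * fderiv ℝ g₁ x (E4.basisVector μ)) *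
        J μ
      = g₁ x * ∑ μ, fderiv ℝ g₂ x (E4.basisVector μ) * J μ +
          g₂ x * ∑ μ, fderiv ℝ g₁ x (E4.basisVector μ) * J μ := by
        rw [Finset.mul_sum, Finset.mul_sum, ← Finset.sum_add_distrib]
        exact Finset.sum_congr rfl fun μ _ ↦ by ring
    _ ≤ 0 := add_nonpos (mul_nonpos_iff.mpr (Or.inl ⟨hg₁, hf₂⟩))
        (mul_nonpos_iff.mpr (Or.inl ⟨hg₂, hf₁⟩))

/-- **Flux of a finite product of nonnegative factors**: if every `g i ≥ 0` (`i ∈ s`) is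
differentiable at `x` with differential pairing nonpositively with `J`, then so is the
differential of `∏_{i ∈ s} g i` (induction on `s`, `sw_mul_flux`). Hawking–Ellis 1973, §4.3,
proof of Lemma 4.3.1. [folklore] -/
private theorem sw_prod_flux {ι : Type*} (s : Finset ι) {g : ι → E4 → ℝ} {x : E4} (J : Fin 4 → ℝ)
    (hd : ∀ i ∈ s, DifferentiableAt ℝ (g i) x) (hg : ∀ i ∈ s, 0 ≤ g i x)
    (hf : ∀ i ∈ s, ∑ μ, fderiv ℝ (g i) x (E4.basisVector μ) * J μ ≤ 0) :
    ∑ μ, fderiv ℝ (fun y ↦ ∏ i ∈ s, g i y) x (E4.basisVector μ) * J μ ≤ 0 := by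
  classical
  induction s using Finset.induction_on with
  | empty => simp
  | insert j s hj ih =>
    have heq : (fun y ↦ ∏ i ∈ insert j s, g i y) = fun y ↦ g j y * ∏ i ∈ s, g i y :=
      funext fun y ↦ Finset.prod_insert hj
    have hds : DifferentiableAt ℝ (fun y ↦ ∏ i ∈ s, g i y) x :=
      (HasFDerivAt.finsetProd (u := s) (g := g) fun i hi ↦
        (hd i (Finset.mem_insert_of_mem hi)).hasFDerivAt).differentiableAt
    rw [heq]
    exact sw_mul_flux J (hd j (Finset.mem_insert_self j s)) hds (hg j (Finset.mem_insert_self j s))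
      (Finset.prod_nonneg fun i hi ↦ hg i (Finset.mem_insert_of_mem hi))
      (hf j (Finset.mem_insert_self j s))
      (ih (fun i hi ↦ hd i (Finset.mem_insert_of_mem hi))
        (fun i hi ↦ hg i (Finset.mem_insert_of_mem hi))
        (fun i hi ↦ hf i (Finset.mem_insert_of_mem hi)))

/-! ### The stub -/

/-- **The weight of the finite-time estimate and the sign of its flux.**
`W = timeSlabCutoff(x⁰) · χ(coneFn A 0 x) · ∏ᵢ χ(u₂ᵢ(qᵢx)/εᵢ − 1)` is `C¹`, takes values in
`[0, 1]`, is supported in `{−2 < x⁰ < A} ∩ {‖x⃗‖ < A − x⁰} ∩ ⋂ᵢ {u₂ᵢ ∘ qᵢ > εᵢ}` (strictly outside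
every boosted horizon), equals `1` on the slab inside `{coneFn ≥ 1} ∩ ⋂ᵢ {u₂ᵢ ∘ qᵢ ≥ 2εᵢ}`, and on
slab exterior points where `G` is pointwise Kerr–Schild (and exactly boosted Kerr in the layers
`{u₂ᵢ ∘ qᵢ ≤ 2εᵢ}`) its differential pairs nonpositively with the lab `dt`-current of every `w`:
the slab cut-off is locally `1`, the cone factor has signed flux for every background
(`Kerr.coneFactor_flux` at the constant background of the point), and each horizon factor has signed
flux (`stub_horizonFactor`) or is locally `1`; the cofactors are nonnegative (`sw_mul_flux`,
`sw_prod_flux`). Hawking–Ellis 1973, §4.3, Lemma 4.3.1; O'Neill 1983, Ch. 14, Lemma 43. [folklore] -/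
theorem stub_slabWeight :
    ∀ {N : ℕ} (M a : Fin N → ℝ) (Λ : Fin N → lorentzGroup) (p : Fin N → E3) (u : Fin N → E4)
      (q : Fin N → E4 → E4),
      (∀ i, u i = (Λ i : E4 ≃L[ℝ] E4) (E4.basisVector 0)) →
      (∀ i x, q i x = poincareInv (Λ i) (E4.ofTimeSpace 0 (p i)) x) →
      (∀ i, 0 < M i) → (∀ i, |a i| ≤ 2⁻¹ * M i) →
      (∀ i, 0 < u i 0 ∧ ‖E4.spatial (u i)‖ ≤ 2⁻¹ * u i 0) →
      (∀ i j, i ≠ j → 40 * (M i + M j) ≤ dist (p i) (p j) ∧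
        0 < ⟪p i - p j, (u i 0)⁻¹ • E4.spatial (u i) - (u j 0)⁻¹ • E4.spatial (u j)⟫_ℝ) →
      ∀ (G : E4 → Fin 4 → Fin 4 → ℝ),
      (∀ x μ ν, G x μ ν = Minkowski.bilin (E4.basisVector μ) (E4.basisVector ν) -
        ∑ i, Real.smoothTransition (2 - Kerr.radius (a i) (q i x) / (8 * M i)) *
          (2 * Kerr.scalarH (M i) (a i) (q i x)) *
          ((Λ i : E4 ≃L[ℝ] E4) (Kerr.nullVector (a i) (q i x))) μ *
          ((Λ i : E4 ≃L[ℝ] E4) (Kerr.nullVector (a i) (q i x))) ν) →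
      ∀ (T A : ℝ) (ε : Fin N → ℝ), T < A → (∀ i, 0 < ε i) →
      ∀ (W : E4 → ℝ),
      (∀ x, W x = Kerr.timeSlabCutoff T A (x 0) * Real.smoothTransition (Kerr.coneFn A 0 x) *
        ∏ i, Real.smoothTransition (Kerr.horizonFn (M i) (a i) (q i x) / ε i - 1)) →
      ContDiff ℝ 1 W ∧ (∀ x, 0 ≤ W x ∧ W x ≤ 1) ∧
      (∀ x, W x ≠ 0 → -2 < x 0 ∧ x 0 < A ∧ E4.spatialNorm x < A - x 0 ∧
        ∀ i, ε i < Kerr.horizonFn (M i) (a i) (q i x)) ∧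
      (∀ x, 0 ≤ x 0 → x 0 ≤ T → 1 ≤ Kerr.coneFn A 0 x →
        (∀ i, 2 * ε i ≤ Kerr.horizonFn (M i) (a i) (q i x)) → W x = 1) ∧
      (∀ (w : E4 → ℝ) (x : E4), 0 ≤ x 0 → x 0 ≤ T →
        (∀ i, Kerr.rPlus (M i) (a i) < Kerr.radius (a i) (q i x)) →
        (∃ (φ₀ : ℝ) (l₀ : E4), 0 ≤ φ₀ ∧
            Minkowski.bilin l₀ l₀ = 0 ∧ Minkowski.bilin l₀ (E4.basisVector 0) = 1 ∧
            ∀ μ ν, G x μ ν = Kerr.etaComp μ ν - φ₀ * l₀ μ * l₀ ν) →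
        (∀ i, Kerr.horizonFn (M i) (a i) (q i x) ≤ 2 * ε i →
          ∀ μ ν, G x μ ν = Minkowski.bilin (E4.basisVector μ) (E4.basisVector ν) -
            2 * Kerr.scalarH (M i) (a i) (q i x) * ((Λ i : E4 ≃L[ℝ] E4) (Kerr.nullVector (a i) (q i x))) μ *
              ((Λ i : E4 ≃L[ℝ] E4) (Kerr.nullVector (a i) (q i x))) ν) →
        ∑ μ, fderiv ℝ W x (E4.basisVector μ) * KerrSchild.normalCurrent G w x μ ≤ 0) := by
  intro N M a Λ p u q hu hq hM ha hv _hsep G _hG T A ε hTA hε W hW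
  -- ### the one-hole input: each boosted receding horizon factor (`stub_horizonFactor`)
  have hHF := fun i ↦ stub_horizonFactor (M i) (a i) (Λ i) (p i) (u i) (q i) (hu i) (hq i) (hM i)
    (ha i) (hv i).1 (ε i) (hε i)
  -- ### smoothness of the three factors
  have hC1 : ∀ i, ContDiff ℝ 1 fun x ↦
      Real.smoothTransition (Kerr.horizonFn (M i) (a i) (q i x) / ε i - 1) := fun i ↦ (hHF i).1
  have hCτ : ContDiff ℝ 1 fun x : E4 ↦ Kerr.timeSlabCutoff T A (x 0) :=
    (Kerr.contDiff_timeSlabCutoff T A).comp contDiff_apply_zero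
  have hCc : ContDiff ℝ 1 fun x ↦ Real.smoothTransition (Kerr.coneFn A 0 x) :=
    Real.smoothTransition.contDiff.comp (Kerr.contDiff_coneFn A 0)
  have hCP : ContDiff ℝ 1 fun x ↦
      ∏ i, Real.smoothTransition (Kerr.horizonFn (M i) (a i) (q i x) / ε i - 1) :=
    contDiff_prod
      (f := fun i x ↦ Real.smoothTransition (Kerr.horizonFn (M i) (a i) (q i x) / ε i - 1))
      fun i _ ↦ hC1 i
  have hWeq : W = fun x ↦ Kerr.timeSlabCutoff T A (x 0) * Real.smoothTransition (Kerr.coneFn A 0 x) *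
      ∏ i, Real.smoothTransition (Kerr.horizonFn (M i) (a i) (q i x) / ε i - 1) := funext hW
  refine ⟨?_, ?_, ?_, ?_, ?_⟩
  · -- ### (1) `W` is `C¹`
    rw [hWeq]
    exact (hCτ.mul hCc).mul hCP
  · -- ### (2) `0 ≤ W ≤ 1`: every factor takes values in `[0, 1]`
    intro x
    have hτ0 := Kerr.timeSlabCutoff_nonneg T A (x 0)
    have hτ1 : Kerr.timeSlabCutoff T A (x 0) ≤ 1 := by
      unfold Kerr.timeSlabCutoff
      exact mul_le_one₀ (Real.smoothTransition.le_one _) (Real.smoothTransition.nonneg _)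
        (Real.smoothTransition.le_one _)
    have hc0 := Real.smoothTransition.nonneg (Kerr.coneFn A 0 x)
    have hc1 := Real.smoothTransition.le_one (Kerr.coneFn A 0 x)
    have hP0 : 0 ≤ ∏ i, Real.smoothTransition (Kerr.horizonFn (M i) (a i) (q i x) / ε i - 1) :=
      Finset.prod_nonneg fun i _ ↦ Real.smoothTransition.nonneg _
    have hP1 : ∏ i, Real.smoothTransition (Kerr.horizonFn (M i) (a i) (q i x) / ε i - 1) ≤ 1 :=
      Finset.prod_le_one (fun i _ ↦ Real.smoothTransition.nonneg _)
        fun i _ ↦ Real.smoothTransition.le_one _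
    rw [hW x]
    exact ⟨mul_nonneg (mul_nonneg hτ0 hc0) hP0, mul_le_one₀ (mul_le_one₀ hτ1 hc0 hc1) hP0 hP1⟩
  · -- ### (3) the support: every factor is nonzero
    intro x hx
    rw [hW x] at hx
    have h12 := left_ne_zero_of_mul hx
    have hP := right_ne_zero_of_mul hx
    have hτ := left_ne_zero_of_mul h12
    have hc := right_ne_zero_of_mul h12
    have ht := Kerr.lt_of_timeSlabCutoff_ne_zero hTA hτ
    refine ⟨ht.1, ht.2, ?_, fun i ↦ ?_⟩
    · -- `χ(u₁) ≠ 0 ⇒ u₁ > 0 ⇒ ‖x⃗‖ < A − x⁰`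
      have hcone : 0 < Kerr.coneFn A 0 x := by
        by_contra h
        exact hc (Real.smoothTransition.zero_of_nonpos (not_lt.mp h))
      have hAx : 0 ≤ A - x 0 := by linarith [ht.2]
      have h2 : 0 < (A - x 0) ^ 2 - ‖E4.spatial x - 0‖ ^ 2 := hcone
      rw [sub_zero] at h2
      refine lt_of_pow_lt_pow_left₀ 2 hAx ?_
      show ‖E4.spatial x‖ ^ 2 < (A - x 0) ^ 2
      linarith
    · -- `χ(u₂ᵢ/εᵢ − 1) ≠ 0 ⇒ u₂ᵢ/εᵢ − 1 > 0 ⇒ εᵢ < u₂ᵢ`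
      have hi : Real.smoothTransition (Kerr.horizonFn (M i) (a i) (q i x) / ε i - 1) ≠ 0 :=
        (Finset.prod_ne_zero_iff.mp hP) i (Finset.mem_univ i)
      have hh : 0 < Kerr.horizonFn (M i) (a i) (q i x) / ε i - 1 := by
        by_contra h
        exact hi (Real.smoothTransition.zero_of_nonpos (not_lt.mp h))
      have : 1 < Kerr.horizonFn (M i) (a i) (q i x) / ε i := by linarith
      rwa [lt_div_iff₀ (hε i), one_mul] at this
  · -- ### (4) `W = 1` on the core: every factor is `1`
    intro x hx0 hxT hcone hcore
    rw [hW x, Kerr.timeSlabCutoff_eq_one hTA (by linarith) (by linarith),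
      Real.smoothTransition.one_of_one_le hcone, one_mul, one_mul]
    exact Finset.prod_eq_one fun i _ ↦ (hHF i).2.2.1 x (hcore i)
  · -- ### (5) the flux at a slab exterior point
    intro w x hx0 hxT hext hpt hlayer
    obtain ⟨φ₀, l₀, hφ₀, hnull, hnorm, hGx⟩ := hpt
    -- Step 1: near `x` the slab cut-off is `1`, so `W = χ(u₁) · ∏ᵢ χ(u₂ᵢ∘qᵢ/εᵢ − 1)` near `x`
    have hev : W =ᶠ[𝓝 x] fun y ↦ Real.smoothTransition (Kerr.coneFn A 0 y) *
        ∏ i, Real.smoothTransition (Kerr.horizonFn (M i) (a i) (q i y) / ε i - 1) := by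
      filter_upwards [Kerr.timeSlabCutoff_eventuallyEq_one hTA hx0 hxT] with y hy
      rw [hW y, show Kerr.timeSlabCutoff T A (y 0) = 1 from hy, one_mul]
    rw [hev.fderiv_eq]
    -- Step 2: the constant background with the coefficients `G(x)`; the cone flux has a sign
    let B₀ : KerrSchild.Background :=
      { φ := fun _ ↦ φ₀, l := fun _ ↦ l₀, bound := φ₀, φ_nonneg := fun _ ↦ hφ₀,
        φ_le := fun _ ↦ le_rfl, null := fun _ _ ↦ hnull, normalised := fun _ _ ↦ hnorm,
        contDiff_inverseMetric := fun μ ν ↦ by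
          simp only [KerrSchild.inverseMetric]
          exact contDiff_const }
    have hGB : G x = B₀.inverseMetric x := by
      funext μ ν
      rw [hGx μ ν]
      rfl
    -- the current depends on the coefficients only through `G x`
    have hcur : ∀ μ, KerrSchild.normalCurrent G w x μ =
        KerrSchild.normalCurrent B₀.inverseMetric w x μ := fun μ ↦ by
      simp only [KerrSchild.normalCurrent, hGB]
    have hxA : x 0 < A := lt_of_le_of_lt hxT hTA
    have hcone : ∑ μ, fderiv ℝ (fun y ↦ Real.smoothTransition (Kerr.coneFn A 0 y)) x
        (E4.basisVector μ) * KerrSchild.normalCurrent G w x μ ≤ 0 :=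
      le_of_eq_of_le (Finset.sum_congr rfl fun μ _ ↦ by rw [hcur μ])
        (Kerr.coneFactor_flux B₀ w (0 : E3) hxA)
    -- Step 3: each horizon factor has signed flux at `x` (in its layer), or is locally `1`
    have hhor : ∀ i, ∑ μ, fderiv ℝ
        (fun y ↦ Real.smoothTransition (Kerr.horizonFn (M i) (a i) (q i y) / ε i - 1)) x
          (E4.basisVector μ) * KerrSchild.normalCurrent G w x μ ≤ 0 := by
      intro i
      rcases le_or_gt (Kerr.horizonFn (M i) (a i) (q i x)) (2 * ε i) with hle | hlt
      · exact (hHF i).2.2.2 G w x (hext i) (hlayer i hle)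
      · -- off the layer: `u₂ᵢ ∘ qᵢ > 2εᵢ` near `x`, where the factor is `1`
        have hcont : Continuous fun y ↦ Kerr.horizonFn (M i) (a i) (q i y) := by
          have hqi : q i = poincareInv (Λ i) (E4.ofTimeSpace 0 (p i)) := funext (hq i)
          have h1 : Continuous (Kerr.horizonFn (M i) (a i)) :=
            ((Kerr.continuous_radius (a i)).sub continuous_const).mul
              (Real.continuous_exp.comp
                ((continuous_const.mul (contDiff_apply_zero (n := 0)).continuous).neg))
          rw [hqi]
          exact h1.comp (continuous_poincareInv _ _)
        have hev1 : (fun y ↦ Real.smoothTransition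
            (Kerr.horizonFn (M i) (a i) (q i y) / ε i - 1)) =ᶠ[𝓝 x] fun _ ↦ (1 : ℝ) := by
          filter_upwards [(isOpen_lt continuous_const hcont).mem_nhds hlt] with y hy
          exact (hHF i).2.2.1 y (le_of_lt hy)
        rw [hev1.fderiv_eq]
        simp
    -- Step 4: Leibniz rule with nonnegative cofactors
    have hdc : DifferentiableAt ℝ (fun y ↦ Real.smoothTransition (Kerr.coneFn A 0 y)) x :=
      (hCc.differentiable (by simp)) x
    have hdP : DifferentiableAt ℝ (fun y ↦
        ∏ i, Real.smoothTransition (Kerr.horizonFn (M i) (a i) (q i y) / ε i - 1)) x :=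
      (hCP.differentiable (by simp)) x
    exact sw_mul_flux (KerrSchild.normalCurrent G w x) hdc hdP (Real.smoothTransition.nonneg _)
      (Finset.prod_nonneg fun i _ ↦ Real.smoothTransition.nonneg _) hcone
      (sw_prod_flux Finset.univ
        (g := fun i y ↦ Real.smoothTransition (Kerr.horizonFn (M i) (a i) (q i y) / ε i - 1))
        (KerrSchild.normalCurrent G w x) (fun i _ ↦ ((hC1 i).differentiable (by simp)) x)
        (fun i _ ↦ Real.smoothTransition.nonneg _) fun i _ ↦ hhor i)

end Summit.FinalStateConjecture.FinalStateConjecture.Cruxes.AdiabaticMultiKerrILED.Sketch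

end
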